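import Summits.QuantumFields.YangMills.Theorems.UnitScaleTiltFluctuationComparisonRegPrGlobalSlack
import Literature.MathematicalPhysics.QuantumFieldTheory.Balaban1983to89.FemtoUniverseGap
import HarnessLib

/-!
# Crux-ideate sketch g12 (ideator 2, lens NEGATION) — audit of 3⁗ lane B «step-gaussian-interpolation»
# (`Cruxes/FluctuationComparisonRegPrL/Ideas/step-gaussian-interpolation.md`, ym-cruxidea-19935-allorder g0)

Seat `ym-cruxidea-19201-2` (planner; crux-ideate ideator 2∕2 on stmt-QuantumFields-19201 `FluctuationComparisonRegPr`,
aside; live twin stmt-QuantumFields-19935 `FluctuationComparisonRegPrL`, v5j‴ STUB 3⁗ `stub_globalTwoRunSlackFam`), gen 12,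
2026-08-27.  EVIDENCE ∕ SKETCH FILE — companion of HOME `FINDING-N9-laneB-audit.md`.  Honest framing: nothing here asserts
the Yang–Mills mass gap, Bałaban's two-run comparison or any registered stub; every Bałaban-side object is a HYPOTHESIS
SCHEMA and every theorem is bookkeeping ∕ elementary analysis over the schemas.  `sorry`-free.

§0  Lane B's schemas `RayDisplayAt`, `RaySupAt` VERBATIM (credit: ym-cruxidea-19935-allorder g0, namespace
    `…FluctuationComparisonRegPrL.IdeateAllOrder`, HOME `pub/ym3-torus/ym-cruxidea-19935-allorder/Sketch.lean`
    sha16 f38e1efb5703ac36; restated because seat sketches are not importable on the farm).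
§1  PROBE 1 (over-constraint): `RaySupAt` read at `t = 0` forces the datum-free shift to carry the rate,
    `|c K n| ≤ C₁·#T_n·L^{-a(K-n)}` (`shift_le_of_raySupAt`) — an unintended clause for any record whose `PintH` does
    not vanish at the flat point.  REPAIR: `RaySupAt₀` bounds `f t − f 0`; `globalSupRateT_of_ray₀` gives lane B's
    conclusion with the SAME constant `2·C₁·Cw²/R²`; `raySupAt₀_of_raySupAt` (the repair is weaker).
§2  PROBE 2 (costume): the CONVERSE `ray_of_globalSupRateT` — from the pure row `GlobalSupRateT D b₀ p₀ a C` one builds,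
    datum by datum, a junk quadratic ray function satisfying `RayDisplayAt` AND `RaySupAt₀` with `C₁ = C·R²/Cw²`.  So the
    schema pair «display ∧ sup row» with `f, τ, c` free is a REFORMULATION of the pure row (round trip: factor 2); the
    analytic content of lane B lives only in a PINNED display (one holomorphic two-run difference per `(K, n)` on the
    record's CONCRETE complex chart, `f` DEFINED as its restriction to the exponential ray) and in the sup row FOR THAT
    function — `pinnedRay` records the shape; FINDING N9 §2 explains why abstract pinning is still gameable.
§3  THE FREE HALF OF THE LEVER (real weights): `abs_log_integral_exp_sub_le` — for positive weights the step free-energy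
    two-run difference is bounded by `sup |S₁ − S₀|` with NO interpolated measure, NO radius, NO cluster expansion
    (elementary monotonicity); `log_integral_exp_neg_add_const` — a configuration-independent constant in the defect shifts
    the free energy EXACTLY (vacuum constants are split off before any sup row is read).
§4  WHY THE FREE HALF DOES NOT REACH `θ²` (power counting): a first-order background channel born at level `h` seen from
    level `n = h − k` carries `L^{3k}·L^{-2k} = L^{k} ≥ 1` (RELEVANT), the second-order channel `L^{3k}·L^{-4k} = L^{-k}`
    (`first_order_channel`, `second_order_channel`).  The sup-norm sandwich sees the background to FIRST order; the
    cancellation of that order ([Balaban1985UV3] (32)) is visible only after the expectation — on COMPLEX backgrounds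
    (Schwarz at B12's absolute radius; positivity lost) or through connected correlations.  Hence lane B's located-unprinted
    row is the complex-background one-step insertion bound for the interpolated step, uniformly in `t ∈ [0,1]`.

References: [Balaban1985UV3] T. Bałaban, CMP 102 (1985) 255–275 ((7) p.257, (32) p.264, (41)–(47) pp.266–267);
[Balaban1987RG1] CMP 109 (1987) (1.11)–(1.18) pp.262–263, p.259; [King1986] C. King, CMP 102 (1986) Thm 3.4 (3.9) p.656;
[GlimmJaffe1987] (9.1.33)–(9.1.34).
-/

noncomputable section

open MeasureTheory Filter Topology Metric Set
open Literature.MathematicalPhysics.QuantumFieldTheory.Balaban1983to89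
open Literature.MathematicalPhysics.QuantumFieldTheory.Balaban1983to89.T3ContinuumYM3Torus
open Literature.MathematicalPhysics.QuantumFieldTheory.Balaban1983to89.T3UnitScaleTilt
open Literature.MathematicalPhysics.QuantumFieldTheory.Balaban1983to89.T3AlphaInputsAC
open Summit.QuantumFields.YangMills.Theorems.GlobalSlack

namespace Summit.QuantumFields.YangMills.Cruxes.FluctuationComparisonRegPr.Ideate2LaneBAudit

/-! ## §0 Lane B's schemas, VERBATIM (ym-cruxidea-19935-allorder g0, `IdeateAllOrder`) -/

/-- The coarse (level-`n`) `SU(2)` gauge fields of the family (lane B's `CoarseField`, verbatim). -/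
abbrev CoarseField (F : T3Family) (n : ℕ) : Type :=
  GaugeField (F.P n) 0 (Matrix.specialUnitaryGroup (Fin 2) ℂ)

variable {F : T3Family} {γ : ℝ}

/-- Lane B's **RAY DISPLAY** schema, VERBATIM (credit ym-cruxidea-19935-allorder g0). [cite: Balaban1987RG1, (1.11)–(1.18) pp.262–263] -/
def RayDisplayAt (D : AlphaDataT3 F γ) (b₀ p₀ Cw R : ℝ)
    (f : (K n : ℕ) → CoarseField F n → ℂ → ℂ) (τ : (K n : ℕ) → CoarseField F n → ℝ) (c : ℕ → ℕ → ℝ) : Prop :=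
  ∀ (K n : ℕ), n ≤ K → ∀ V : CoarseField F n, PlaqSmall (θBal F.L γ b₀ p₀ n) V →
    DifferentiableOn ℂ (f K n V) (ball 0 R) ∧
    |τ K n V| ≤ Cw * θBal F.L γ b₀ p₀ n ∧
    f K n V (τ K n V) = ((D.PintH (K + 1) n V - D.PintH K n V : ℝ) : ℂ) ∧
    f K n V 0 = ((c K n : ℝ) : ℂ) ∧
    deriv (f K n V) 0 = 0

/-- Lane B's **ALL-ORDER SUP ROW ON THE ABSOLUTE DISC**, VERBATIM (credit ym-cruxidea-19935-allorder g0). -/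
def RaySupAt (F : T3Family) (γ b₀ p₀ R a C₁ : ℝ) (f : (K n : ℕ) → CoarseField F n → ℂ → ℂ) : Prop :=
  ∀ (K n : ℕ), n ≤ K → ∀ V : CoarseField F n, PlaqSmall (θBal F.L γ b₀ p₀ n) V →
    ∀ t ∈ ball (0 : ℂ) R, ‖f K n V t‖ ≤ C₁ * (Fintype.card (Site (F.P n) 0) : ℝ) * (((F.L : ℝ) ^ (K - n))⁻¹) ^ a

/-! ## §1 Probe 1: `RaySupAt` at `t = 0` constrains the shift; the repaired schema bounds `f − f 0` -/

/-- **PROBE 1.** Display + lane B's sup row force the datum-free shift to carry the rate: read `RaySupAt` at `t = 0`.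
(For print's polynomial activities (43), `PintH` vanishes at the flat point and `c = 0` is harmless; for an un-expanded
record carrying configuration-independent constants it is an unintended constraint — repair below.) -/
theorem shift_le_of_raySupAt {D : AlphaDataT3 F γ} {b₀ p₀ Cw R a C₁ : ℝ}
    {f : (K n : ℕ) → CoarseField F n → ℂ → ℂ} {τ : (K n : ℕ) → CoarseField F n → ℝ} {c : ℕ → ℕ → ℝ}
    (hR : 0 < R) (hdisp : RayDisplayAt D b₀ p₀ Cw R f τ c) (hsup : RaySupAt F γ b₀ p₀ R a C₁ f) :
    ∀ (K n : ℕ), n ≤ K → ∀ V : CoarseField F n, PlaqSmall (θBal F.L γ b₀ p₀ n) V →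
      |c K n| ≤ C₁ * (Fintype.card (Site (F.P n) 0) : ℝ) * (((F.L : ℝ) ^ (K - n))⁻¹) ^ a := by
  intro K n hn V hV
  obtain ⟨_, _, _, hflat, _⟩ := hdisp K n hn V hV
  have h0 := hsup K n hn V hV 0 (mem_ball_self hR)
  rwa [hflat, Complex.norm_real, Real.norm_eq_abs] at h0

/-- **REPAIRED SUP ROW** (schema): the sup over the absolute disc of the FLAT-SUBTRACTED ray function,
`‖f t − f 0‖ ≤ C₁·#T_n·L^{-a(K-n)}`.  Weaker than `RaySupAt` (`raySupAt₀_of_raySupAt`) and exactly what the order-2 Schwarz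
step consumes (`globalSupRateT_of_ray₀`). -/
def RaySupAt₀ (F : T3Family) (γ b₀ p₀ R a C₁ : ℝ) (f : (K n : ℕ) → CoarseField F n → ℂ → ℂ) : Prop :=
  ∀ (K n : ℕ), n ≤ K → ∀ V : CoarseField F n, PlaqSmall (θBal F.L γ b₀ p₀ n) V →
    ∀ t ∈ ball (0 : ℂ) R,
      ‖f K n V t - f K n V 0‖ ≤ C₁ * (Fintype.card (Site (F.P n) 0) : ℝ) * (((F.L : ℝ) ^ (K - n))⁻¹) ^ a

/-- Lane B's sup row implies the repaired one with twice the constant. -/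
theorem raySupAt₀_of_raySupAt {b₀ p₀ R a C₁ : ℝ} {f : (K n : ℕ) → CoarseField F n → ℂ → ℂ}
    (hsup : RaySupAt F γ b₀ p₀ R a C₁ f) : RaySupAt₀ F γ b₀ p₀ R a (2 * C₁) f := by
  intro K n hn V hV t ht
  have hR : 0 < R := lt_of_le_of_lt (norm_nonneg t) (mem_ball_zero_iff.mp ht)
  have h1 := hsup K n hn V hV t ht
  have h0 := hsup K n hn V hV 0 (mem_ball_self hR)
  calc ‖f K n V t - f K n V 0‖ ≤ ‖f K n V t‖ + ‖f K n V 0‖ := norm_sub_le _ _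
    _ ≤ C₁ * (Fintype.card (Site (F.P n) 0) : ℝ) * (((F.L : ℝ) ^ (K - n))⁻¹) ^ a
        + C₁ * (Fintype.card (Site (F.P n) 0) : ℝ) * (((F.L : ℝ) ^ (K - n))⁻¹) ^ a := add_le_add h1 h0
    _ = 2 * C₁ * (Fintype.card (Site (F.P n) 0) : ℝ) * (((F.L : ℝ) ^ (K - n))⁻¹) ^ a := by ring

/-- **DISPLAY + REPAIRED SUP ROW ⇒ PURE RATE** — lane B's `globalSupRateT_of_ray` with the weaker hypothesis and the SAME
constant `2·C₁·Cw²/R²` (Schwarz applied to `f − f 0`). -/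
theorem globalSupRateT_of_ray₀ {D : AlphaDataT3 F γ} {b₀ p₀ Cw R a C₁ : ℝ}
    {f : (K n : ℕ) → CoarseField F n → ℂ → ℂ} {τ : (K n : ℕ) → CoarseField F n → ℝ} {c : ℕ → ℕ → ℝ}
    (hR : 0 < R) (hwin : ∀ n, Cw * θBal F.L γ b₀ p₀ n < R)
    (hdisp : RayDisplayAt D b₀ p₀ Cw R f τ c) (hsup : RaySupAt₀ F γ b₀ p₀ R a C₁ f) :
    GlobalSupRateT D b₀ p₀ a (2 * C₁ * Cw ^ 2 / R ^ 2) := by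
  refine ⟨c, fun K n hn V hV => ?_⟩
  obtain ⟨hd, hτ, hread, hflat, hder⟩ := hdisp K n hn V hV
  set M : ℝ := C₁ * (Fintype.card (Site (F.P n) 0) : ℝ) * (((F.L : ℝ) ^ (K - n))⁻¹) ^ a with hMdef
  have hgd : DifferentiableOn ℂ (fun s => f K n V s - f K n V 0) (ball 0 R) := hd.sub_const _
  have hgM : ∀ s ∈ ball (0 : ℂ) R, ‖(fun s => f K n V s - f K n V 0) s‖ ≤ M :=
    fun s hs => hsup K n hn V hV s hs
  have hgder : deriv (fun s => f K n V s - f K n V 0) 0 = 0 := by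
    rw [deriv_sub_const, hder]
  have hnormτ : ‖((τ K n V : ℝ) : ℂ)‖ = |τ K n V| := by
    rw [Complex.norm_real, Real.norm_eq_abs]
  have ht : ((τ K n V : ℝ) : ℂ) ∈ ball (0 : ℂ) R := by
    rw [mem_ball_zero_iff, hnormτ]
    exact lt_of_le_of_lt hτ (hwin n)
  have key := FemtoUniverseGap.norm_sub_apply_zero_le_of_deriv_eq_zero hgd hgM hgder ht
  have e : (fun s => f K n V s - f K n V 0) ((τ K n V : ℝ) : ℂ) - (fun s => f K n V s - f K n V 0) 0
      = ((D.PintH (K + 1) n V - D.PintH K n V - c K n : ℝ) : ℂ) := by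
    simp only [sub_self, sub_zero]
    rw [hread, hflat]; push_cast; ring
  rw [e, Complex.norm_real, Real.norm_eq_abs] at key
  have hM0 : 0 ≤ M := (norm_nonneg _).trans (hgM 0 (mem_ball_self hR))
  have hτ' : ‖((τ K n V : ℝ) : ℂ)‖ ≤ Cw * θBal F.L γ b₀ p₀ n := hnormτ ▸ hτ
  calc |D.PintH (K + 1) n V - D.PintH K n V - c K n|
      ≤ 2 * M * (‖((τ K n V : ℝ) : ℂ)‖ / R) ^ 2 := key
    _ ≤ 2 * M * ((Cw * θBal F.L γ b₀ p₀ n) / R) ^ 2 := by gcongr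
    _ = 2 * C₁ * Cw ^ 2 / R ^ 2 * θBal F.L γ b₀ p₀ n ^ 2 * (Fintype.card (Site (F.P n) 0) : ℝ)
          * (((F.L : ℝ) ^ (K - n))⁻¹) ^ a := by
      rw [hMdef]; field_simp

/-! ## §2 Probe 2 (costume): the converse — the pure row builds a display and a sup row, datum by datum -/

/-- **THE CONVERSE.**  From the pure row alone one constructs `f, τ, c` satisfying lane B's `RayDisplayAt` and the repaired
sup row with `C₁ = C·R²/Cw²`: `τ_V := Cw·θ(n)` and the JUNK quadratic `f_V(t) := c K n + (d(V) − c K n)·t²/(Cw θ(n))²`,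
`d(V)` the two-run difference.  Consequently «`∃ f τ c`, display ∧ sup row» is EQUIVALENT to the pure row up to a factor
`2` (`globalSupRateT_of_ray₀`), i.e. the schema pair carries no analytic content unless `f` is PINNED (§2b). -/
theorem ray_of_globalSupRateT {D : AlphaDataT3 F γ} {b₀ p₀ a C Cw R : ℝ}
    (hL : 1 ≤ F.L) (hγ : 0 < γ) (hγ1 : γ ≤ 1) (hb : 0 < b₀) (hCw : 0 < Cw)
    (h : GlobalSupRateT D b₀ p₀ a C) :
    ∃ (f : (K n : ℕ) → CoarseField F n → ℂ → ℂ) (τ : (K n : ℕ) → CoarseField F n → ℝ) (c : ℕ → ℕ → ℝ),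
      RayDisplayAt D b₀ p₀ Cw R f τ c ∧ RaySupAt₀ F γ b₀ p₀ R a (C * R ^ 2 / Cw ^ 2) f := by
  obtain ⟨c, hc⟩ := h
  have hθpos : ∀ n, 0 < θBal F.L γ b₀ p₀ n :=
    fun n => T3MinimiserStabilityReduction.θBal_pos hL hγ hγ1 hb p₀ n
  -- the junk coefficient `B K n V = (d(V) − c K n)/(Cw θ(n))²`
  set B : (K n : ℕ) → CoarseField F n → ℝ :=
    fun K n V => (D.PintH (K + 1) n V - D.PintH K n V - c K n) / (Cw * θBal F.L γ b₀ p₀ n) ^ 2 with hBdef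
  refine ⟨fun K n V t => ((c K n : ℝ) : ℂ) + ((B K n V : ℝ) : ℂ) * t ^ 2,
    fun K n V => Cw * θBal F.L γ b₀ p₀ n, c, ?_, ?_⟩
  · intro K n hn V hV
    have hτ0 : (0 : ℝ) < Cw * θBal F.L γ b₀ p₀ n := mul_pos hCw (hθpos n)
    refine ⟨?_, ?_, ?_, ?_, ?_⟩
    · -- a polynomial is holomorphic
      apply Differentiable.differentiableOn
      fun_prop
    · rw [abs_of_pos hτ0]
    · -- reads the two-run difference at `τ`
      show ((c K n : ℝ) : ℂ) + ((B K n V : ℝ) : ℂ) * (((Cw * θBal F.L γ b₀ p₀ n : ℝ) : ℂ)) ^ 2 = _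
      have hBτ : B K n V * (Cw * θBal F.L γ b₀ p₀ n) ^ 2
          = D.PintH (K + 1) n V - D.PintH K n V - c K n := by
        rw [hBdef]
        exact div_mul_cancel₀ _ (pow_ne_zero 2 hτ0.ne')
      rw [← Complex.ofReal_pow, ← Complex.ofReal_mul, hBτ]
      push_cast; ring
    · show ((c K n : ℝ) : ℂ) + ((B K n V : ℝ) : ℂ) * (0 : ℂ) ^ 2 = _
      simp
    · -- vanishing first derivative at the flat point
      show deriv (fun t : ℂ => ((c K n : ℝ) : ℂ) + ((B K n V : ℝ) : ℂ) * t ^ 2) 0 = 0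
      have hda : HasDerivAt (fun t : ℂ => ((c K n : ℝ) : ℂ) + ((B K n V : ℝ) : ℂ) * t ^ 2)
          (0 + ((B K n V : ℝ) : ℂ) * ((2 : ℕ) * (0 : ℂ) ^ (2 - 1))) 0 :=
        (hasDerivAt_const (0 : ℂ) _).add (((hasDerivAt_pow 2 (0 : ℂ))).const_mul _)
      rw [hda.deriv]; simp
  · intro K n hn V hV t ht
    have hτ0 : (0 : ℝ) < Cw * θBal F.L γ b₀ p₀ n := mul_pos hCw (hθpos n)
    have hrow := hc K n hn V hV
    have htR : ‖t‖ < R := mem_ball_zero_iff.mp ht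
    have hR : 0 < R := lt_of_le_of_lt (norm_nonneg t) htR
    -- the flat-subtracted junk function is `B·t²`
    have e : ‖(((c K n : ℝ) : ℂ) + ((B K n V : ℝ) : ℂ) * t ^ 2)
        - (((c K n : ℝ) : ℂ) + ((B K n V : ℝ) : ℂ) * (0 : ℂ) ^ 2)‖ = |B K n V| * ‖t‖ ^ 2 := by
      simp [Complex.norm_real, norm_pow]
    show ‖(((c K n : ℝ) : ℂ) + ((B K n V : ℝ) : ℂ) * t ^ 2)
        - (((c K n : ℝ) : ℂ) + ((B K n V : ℝ) : ℂ) * (0 : ℂ) ^ 2)‖ ≤ _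
    rw [e]
    -- size of the junk coefficient from the pure row
    set X : ℝ := C * (Fintype.card (Site (F.P n) 0) : ℝ) * (((F.L : ℝ) ^ (K - n))⁻¹) ^ a with hXdef
    have hrow' : |D.PintH (K + 1) n V - D.PintH K n V - c K n| ≤ θBal F.L γ b₀ p₀ n ^ 2 * X := by
      rw [hXdef]; calc _ ≤ _ := hrow
        _ = _ := by ring
    have hX0 : 0 ≤ X := by
      have h2 : 0 ≤ θBal F.L γ b₀ p₀ n ^ 2 * X := (abs_nonneg _).trans hrow'
      exact (mul_nonneg_iff_of_pos_left (pow_pos (hθpos n) 2)).mp h2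
    have hB : |B K n V| ≤ X / Cw ^ 2 := by
      rw [hBdef, abs_div, abs_of_pos (pow_pos hτ0 2), div_le_div_iff₀ (pow_pos hτ0 2) (pow_pos hCw 2)]
      calc |D.PintH (K + 1) n V - D.PintH K n V - c K n| * Cw ^ 2
          ≤ θBal F.L γ b₀ p₀ n ^ 2 * X * Cw ^ 2 := by gcongr
        _ = X * (Cw * θBal F.L γ b₀ p₀ n) ^ 2 := by ring
    have ht2 : ‖t‖ ^ 2 ≤ R ^ 2 := by gcongr
    calc |B K n V| * ‖t‖ ^ 2 ≤ X / Cw ^ 2 * R ^ 2 := by gcongr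
      _ = C * R ^ 2 / Cw ^ 2 * (Fintype.card (Site (F.P n) 0) : ℝ) * (((F.L : ℝ) ^ (K - n))⁻¹) ^ a := by
          rw [hXdef]; ring

/-- **ROUND TRIP**: pure row `C` ⇒ (junk display ∧ repaired sup row) ⇒ pure row `2C` — the schema pair is a reformulation. -/
theorem globalSupRateT_roundTrip {D : AlphaDataT3 F γ} {b₀ p₀ a C Cw R : ℝ}
    (hL : 1 ≤ F.L) (hγ : 0 < γ) (hγ1 : γ ≤ 1) (hb : 0 < b₀) (hCw : 0 < Cw) (hR : 0 < R)
    (hwin : ∀ n, Cw * θBal F.L γ b₀ p₀ n < R) (h : GlobalSupRateT D b₀ p₀ a C) :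
    GlobalSupRateT D b₀ p₀ a (2 * (C * R ^ 2 / Cw ^ 2) * Cw ^ 2 / R ^ 2) := by
  obtain ⟨f, τ, c, hdisp, hsup⟩ := ray_of_globalSupRateT (R := R) hL hγ hγ1 hb hCw h
  exact globalSupRateT_of_ray₀ hR hwin hdisp hsup

/-- the round-trip constant is `2C`. -/
theorem roundTrip_const {C Cw R : ℝ} (hCw : Cw ≠ 0) (hR : R ≠ 0) :
    2 * (C * R ^ 2 / Cw ^ 2) * Cw ^ 2 / R ^ 2 = 2 * C := by
  field_simp

/-! ### §2b The non-costume shape: a PINNED ray function -/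

/-- **PINNED RAY FUNCTION** (shape only): `f` is READ OFF one displayed function `𝔇 K n` on a complex chart `X n` along a
displayed ray map — so a sup row for `f` quantifies over ONE function per `(K, n)`, not over a function chosen datum by
datum as in `ray_of_globalSupRateT`.  FINDING N9 §2: the chart `X n` and the ray must be the record's CONCRETE complexified
configuration space and exponential ray (an abstract triple `(X, ray, 𝔇)` is still gameable). -/
def pinnedRay {F : T3Family} {X : ℕ → Type} (𝔇 : (K n : ℕ) → X n → ℂ)
    (ray : (n : ℕ) → CoarseField F n → ℂ → X n) : (K n : ℕ) → CoarseField F n → ℂ → ℂ :=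
  fun K n V t => 𝔇 K n (ray n V t)

/-- With a pinned ray function whose rays share the flat point, the value at `0` is automatically datum-free. -/
theorem pinnedRay_flat {X : ℕ → Type} {𝔇 : (K n : ℕ) → X n → ℂ} {ray : (n : ℕ) → CoarseField F n → ℂ → X n}
    (hflat : ∀ n (V W : CoarseField F n), ray n V 0 = ray n W 0) (K n : ℕ) (V W : CoarseField F n) :
    pinnedRay 𝔇 ray K n V 0 = pinnedRay 𝔇 ray K n W 0 := by
  simp [pinnedRay, hflat n V W]

/-! ## §3 The free half of the lever: the real-weight sandwich and the exact constant split -/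

/-- **FREE HALF (real weights).**  For positive weights the free-energy difference of two actions is bounded by the sup of
their difference — no interpolated measure, no analyticity radius, no cluster expansion:
`|log ∫ e^{-S₁} dμ − log ∫ e^{-S₀} dμ| ≤ δ` whenever `|S₁ − S₀| ≤ δ` pointwise.  (The born two-run difference of one
matched step on REAL backgrounds; FINDING N9 §3–§4 explains why this does not reach the `θ²` extraction.)
[cite: GlimmJaffe1987, (9.1.33)–(9.1.34)] -/
theorem abs_log_integral_exp_sub_le {α : Type*} [MeasurableSpace α] {μ : Measure α} {S₀ S₁ : α → ℝ} {δ : ℝ}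
    (h₀ : Integrable (fun x => Real.exp (-S₀ x)) μ) (h₁ : Integrable (fun x => Real.exp (-S₁ x)) μ)
    (hZ₀ : 0 < ∫ x, Real.exp (-S₀ x) ∂μ) (hZ₁ : 0 < ∫ x, Real.exp (-S₁ x) ∂μ)
    (hδ : ∀ x, |S₁ x - S₀ x| ≤ δ) :
    |Real.log (∫ x, Real.exp (-S₁ x) ∂μ) - Real.log (∫ x, Real.exp (-S₀ x) ∂μ)| ≤ δ := by
  have h10 : ∀ x, Real.exp (-S₁ x) ≤ Real.exp δ * Real.exp (-S₀ x) := fun x => by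
    rw [← Real.exp_add]
    have := hδ x; rw [abs_le] at this
    exact Real.exp_le_exp.mpr (by linarith)
  have h01 : ∀ x, Real.exp (-S₀ x) ≤ Real.exp δ * Real.exp (-S₁ x) := fun x => by
    rw [← Real.exp_add]
    have := hδ x; rw [abs_le] at this
    exact Real.exp_le_exp.mpr (by linarith)
  have hZ1le : ∫ x, Real.exp (-S₁ x) ∂μ ≤ Real.exp δ * ∫ x, Real.exp (-S₀ x) ∂μ := by
    rw [← integral_const_mul]
    exact integral_mono h₁ (h₀.const_mul _) h10
  have hZ0le : ∫ x, Real.exp (-S₀ x) ∂μ ≤ Real.exp δ * ∫ x, Real.exp (-S₁ x) ∂μ := by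
    rw [← integral_const_mul]
    exact integral_mono h₀ (h₁.const_mul _) h01
  rw [abs_sub_le_iff]
  constructor
  · have h := Real.log_le_log hZ₁ hZ1le
    rw [Real.log_mul (Real.exp_pos δ).ne' hZ₀.ne', Real.log_exp] at h
    linarith
  · have h := Real.log_le_log hZ₀ hZ0le
    rw [Real.log_mul (Real.exp_pos δ).ne' hZ₁.ne', Real.log_exp] at h
    linarith

/-- **EXACT CONSTANT SPLIT**: a configuration-independent constant `E` in the action shifts the free energy by exactly `−E`
(vacuum constants of the two runs are split off BEFORE any sup row is read; they never enter `RaySupAt₀`). -/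
theorem log_integral_exp_neg_add_const {α : Type*} [MeasurableSpace α] {μ : Measure α} (S : α → ℝ) (E : ℝ)
    (hZ : 0 < ∫ x, Real.exp (-S x) ∂μ) :
    Real.log (∫ x, Real.exp (-(S x + E)) ∂μ) = -E + Real.log (∫ x, Real.exp (-S x) ∂μ) := by
  have e : (fun x => Real.exp (-(S x + E))) = fun x => Real.exp (-E) * Real.exp (-S x) := by
    funext x; rw [← Real.exp_add]; congr 1; ring
  rw [e, integral_const_mul, Real.log_mul (Real.exp_pos _).ne' hZ.ne', Real.log_exp]

/-- the sandwich is SHARP for a constant defect (so no better t-free bound exists in general). -/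
theorem log_integral_exp_const_defect {α : Type*} [MeasurableSpace α] {μ : Measure α} (S : α → ℝ) (E : ℝ)
    (hZ : 0 < ∫ x, Real.exp (-S x) ∂μ) :
    |Real.log (∫ x, Real.exp (-(S x + E)) ∂μ) - Real.log (∫ x, Real.exp (-S x) ∂μ)| = |E| := by
  rw [log_integral_exp_neg_add_const S E hZ]
  simp [abs_neg]

/-! ## §4 Power counting: why the sup-norm sandwich cannot deliver `θ²` -/

/-- **FIRST-ORDER BACKGROUND CHANNEL IS RELEVANT** in `d = 3`: `L^{3k}` birth blocks per coarse block × one curvature factor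
rescaled by `L^{-2k}` give `L^{k} ≥ 1`.  (The sup-norm sandwich sees the background dependence of the step-action defect to
first order; its cancellation — [Balaban1985UV3] (32), no invariant linear forms for semi-simple `G` — happens only inside
the expectation.) [cite: Balaban1985UV3, (32) p.264; (44) p.267] -/
theorem first_order_channel {L : ℝ} (hL : 1 ≤ L) (k : ℕ) :
    L ^ (3 * k) * (L ^ (2 * k))⁻¹ = L ^ k ∧ 1 ≤ L ^ k := by
  have hL0 : 0 < L := lt_of_lt_of_le zero_lt_one hL
  refine ⟨?_, one_le_pow₀ hL⟩
  rw [show 3 * k = k + 2 * k by ring, pow_add, mul_inv_cancel_right₀ (pow_ne_zero _ hL0.ne')]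

/-- **SECOND-ORDER BACKGROUND CHANNEL IS CONTRACTING** («marginal by one»): `L^{3k}·L^{-4k} = L^{-k}` — lane B's slice
factor, available only after the first order has cancelled. [cite: Balaban1985UV3, (44) p.267] -/
theorem second_order_channel {L : ℝ} (hL : 0 < L) (k : ℕ) :
    L ^ (3 * k) * (L ^ (4 * k))⁻¹ = (L ^ k)⁻¹ := by
  rw [show 4 * k = 3 * k + k by ring, pow_add, mul_inv, ← mul_assoc, mul_inv_cancel₀ (pow_ne_zero _ hL.ne'), one_mul]

end Summit.QuantumFields.YangMills.Cruxes.FluctuationComparisonRegPr.Ideate2LaneBAudit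

end
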